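import Literature.MathematicalPhysics.QuantumFieldTheory.Balaban1983to89.B9Eq326LocalPartBlockDecayTowerClosed
import Literature.MathematicalPhysics.QuantumFieldTheory.Balaban1983to89.B9Eq3126ClosingRadiusWindowTower

/-!
# `Balaban1983to89.B9Eq326LocalPartBlockDecayTowerClosedRadius` — T. Bałaban, *Propagators for lattice gauge theories in a background field*, Commun. Math.
# Phys. **99** (1985) 389–434 [Balaban1985BackgroundPropagators] (3.26) p. 395 (the local part `A₀ = Δ(U) + D_UD*_U + Q*aQ`), (3.15)–(3.16) p. 393, (3.49) p. 399
# («the constants … independent of the field configuration»), Thm 3.11 p. 416: **THE `L²` BIG-BLOCK DECAY OF THE TOWER LOCAL PART `A₀,k⁻¹` AT EVERY HEIGHT WITH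
# THE RATE CHOSEN ONCE — `∃ r₀ > 0` IN CLOSED FORM BEFORE `∀ n η c₀ c₁ m U`** — ne9-leaf-03 g78's (D0TC)
# `B9Eq326LocalPartBlockDecayTowerClosed.norm_block_localInvK_le_closed` at the closing radius of this lineage's (CRWT) `B9Eq3126ClosingRadiusWindowTower` read at
# `μ₁ := 1` (the radius of the `G₁` row: it carries the `G′_k`-side ratios in `γ′, κ₁, M`, which are IDLE for the local part — no projection `R`, so no `dR`
# and no `C_P` — and are kept only so that ONE radius serves `G₁,k`, `H₁,k`, `(Q_kG₁,kQ_k†)⁻¹` and `A₀,k`; `ℓ = ℓ′ = 1`, `β := N_βr₀`, `β_K := 8p_K⁰r₀`; the tower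
# `dQ` window linearised height-free on the diagonal), given ONLY `γ` + `hpos₀` for `A₀`, a bound `p_K⁰` of the curvature letter and the MODEL letters with the
# geometric bond-window profile — the local-part twin of (EG1TC) `B9Eq326DeltaABlockDecayTowerClosedRadius`; the `hdec` supplier of (EA0S)

statement-level skeleton of published theorems with citation tags; proofs where landed; nothing here is a claim about the Yang–Mills mass gap

CITATION HEADER (lean-in-tree rule).  Audit cell `pub-balaban`, sub-cell `t4`, BINDER row NE9 (road ΔA-CT, leaf prover 03 `b2b-balaban-t4-ne9-formalise-leaf-03`
gen 78).  Imports BY NAME: this lineage's (D0TC) `B9Eq326LocalPartBlockDecayTowerClosed` and (CRWT) `B9Eq3126ClosingRadiusWindowTower` (`radiusT0_pos`,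
`le_ratios_of_le_radiusT0`, `eta_windows`, `unit_windows`, `slopes_le`, `small_window`, `tower_dQ_diff_le_linear`).  Sources READ first-hand:
[Balaban1985BackgroundPropagators] (`paper:balaban1985-cmp99-background-propagators`) p. 393 (3.15)–(3.16).  Print's decay is the random walk of Sect. C; the cell's
road is Combes–Thomas with explicit windows; `r₀` is the cell's closed form, NOT print's `δ₀`.

WHAT IS PROVED (sorry-free; proof lane — no `def`; [folklore] composition BY NAME + (CRWT)'s arithmetic).
* **`exists_rate_block_decay_localInvK_closed`** — for the letters `(d, L ≥ 2, M_φ, M_φ′, M_τ, a, a′, ε_s, ϱ < 1, γ′ ≤ 1, κ₁, M, γ, p_K⁰ < γ∕2)`: `∃ r₀`,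
  `r₀ = ` the closed radius of (CRWT) at `μ₁ := 1`, `0 < r₀`, and for every height `n`, spacing `η` (`ηL^{n+1} = 1`), weights on the diagonal, lattice `m`,
  background `U` of the MODEL letters (unit ball, `hRS`, per-level data, geometric profile `ε_j ≤ ε_sϱ^j`, plaquette letters `δ` with the curvature letter
  `≤ p_K⁰`), ANY positivity witness `hpos₀` of the tower local part `A₀` with `γ`-coercivity:
  `‖P_{y₁} ∘ A₀⁻¹ ∘ P_{y₀}‖ ≤ (4∕γ)e^{r₀}·e^{−r₀·d_m(y₀,y₁)}`.
HONEST SCOPE.  Composition; `γ` + `hpos₀`, `p_K⁰`, the idle `γ′, a′, κ₁, M` and the MODEL letters are INPUTS (the closing with (LDC)'s letters is the sequel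
(FCL0)); crude constants; NOT print's `δ₀`, NOT a kernel bound; NOT NE9 (cell pub-balaban: NE9 NOT PRINTED ∕ NOT PROVED; «NE9 ⇐ the named binders»; row WALLED
ON A MODEL (O-NE9-1; #5 UNRULED); spine PROVED 0∕9; rung (B)+1 on a finite T⁴ — NOT infinite volume, NOT mass gap, NOT BetaPertH, NOT Clay; HONEST DEPENDENCY:
continuum YM on T⁴ ⇐ BetaPertH ∧ nine spine estimates (0/9 proved); BetaPertH ⇐ (D1) ∧ (D4) ∧ CAP+tail; G-an2-4 gates asym, D1 and NE2/3/4).  NEW file; nothing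
modified.  Net new unproved facts: 0.
-/

noncomputable section

set_option autoImplicit false

open scoped InnerProductSpace ComplexConjugate BigOperators
open NormedSpace

namespace Literature.MathematicalPhysics.QuantumFieldTheory.Balaban1983to89.B9Eq326LocalPartBlockDecayTowerClosedRadius

open B4Sect5Torus (TSite tdist)
open B4Sect5Proof (latticeConst)
open B9SectCLatticeCarrier (Bond DirPair bpos btgt)
open B9Eq311L2Pairing (WL2)
open B9Eq319QprimeTorus (fineP blockCoord)
open B9Eq315QTower (towerP UlevOf)
open B9Eq315QTorus (perCfg cornerSite)
open B7Prop1Explicit (U1 Wcx boxVec)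
open B9Eq316TowerFlatIsOneStep (siteCast towerP_eq_fineP_pow)
open B11Eq103H1Complex (SiteL2K BondL2K covDerivL2K covDivL2K)
open B9Eq310DeltaPrime (reHol imHol)
open B9Eq310HessianOperator (adTransportW curvOp)
open B9Eq326OperatorTower (QkW)
open B9Eq326LocalPartBlockDecayTowerClosed (norm_block_localInvK_le_closed)
open B11Eq103H1Complex (greenK)
open B9Eq310HessianOperator (hessOp)
open B9Eq3126ClosingRadiusWindowTower (radiusT0_pos le_ratios_of_le_radiusT0 eta_windows unit_windows slopes_le small_window tower_dQ_diff_le_linear)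

variable {d : ℕ} (L : ℕ) [NeZero L] (hL2 : 2 ≤ L)
  {𝔸 : Type*} [NormedRing 𝔸] [StarRing 𝔸] [NormedAlgebra ℂ 𝔸] [StarModule ℂ 𝔸] [CompleteSpace 𝔸] [NormOneClass 𝔸]
  {W : Type*} [NormedAddCommGroup W] [InnerProductSpace ℂ W] [FiniteDimensional ℂ W] (φ : W ≃ₗ[ℂ] 𝔸) {Mφ Mφ' : ℝ}
  (hφ : ∀ w, ‖φ w‖ ≤ Mφ * ‖w‖) (hφ' : ∀ X, ‖φ.symm X‖ ≤ Mφ' * ‖X‖) (hMφ : 0 ≤ Mφ) (hMφ' : 0 ≤ Mφ') (hstar : ∀ X : 𝔸, ‖star X‖ ≤ ‖X‖)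
  (τ : 𝔸 →ₗ[ℂ] ℂ) {Mτ : ℝ} (hτ : ∀ X Y : 𝔸, ‖τ (X * Y)‖ ≤ Mτ * ‖X‖ * ‖Y‖) (hMτ : 0 ≤ Mτ)
  (a : ℝ) (ha : 0 ≤ a) {a' : ℝ} (ha' : 0 ≤ a') {ϱ εs : ℝ} (hϱ0 : 0 ≤ ϱ) (hϱ1 : ϱ < 1) (hεs : 0 ≤ εs)
  {γ' κ₁ M : ℝ} (hγ' : 0 < γ') (hγ'1 : γ' ≤ 1) (hκ₁ : 0 < κ₁) (hM : 0 ≤ M)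
  {γ pK0 : ℝ} (hγ : 0 < γ) (hpK0 : 0 ≤ pK0) (hgap : pK0 < γ / 2)

/-- The local part's window from the `G₁` window of (CRWT): `p∕2 + (21+3a)β² + 4βC_P + 2ρC_P² + β_K ≤ γ∕4` ⟹ `p∕2 + 3(2+a)β² + β_K ≤ γ∕4`
(`0 ≤ β, C_P, ρ`). [folklore] [cite: Balaban1985BackgroundPropagators, Thm 3.11 p.416] -/
theorem small_local_of_small {p a β CP ρ βK γ : ℝ} (hβ : 0 ≤ β) (hCP : 0 ≤ CP) (hρ : 0 ≤ ρ)
    (h : p / 2 + (21 + 3 * a) * β ^ 2 + 4 * β * CP + 2 * ρ * CP ^ 2 + βK ≤ γ / 4) : p / 2 + 3 * (2 + a) * β ^ 2 + βK ≤ γ / 4 := by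
  nlinarith [sq_nonneg β, mul_nonneg hβ hCP, mul_nonneg hρ (sq_nonneg CP)]

set_option maxHeartbeats 1600000 in
include hL2 hφ hφ' hMφ hMφ' hstar hτ hMτ ha ha' hϱ0 hϱ1 hεs hγ' hκ₁ hM hγ hpK0 hgap in
/-- **THE `L²` BIG-BLOCK DECAY OF THE TOWER LOCAL PART `A₀,k⁻¹` AT EVERY HEIGHT, THE RATE CHOSEN ONCE: `∃ r₀ > 0` (closed form, the radius of
`B9Eq3126ClosingRadiusWindowTower` at `μ₁ := 1`) BEFORE `∀ n η c₀ c₁ m U`.**  (D0TC) `norm_block_localInvK_le_closed` at `r := r₀`, `ℓ = ℓ′ = 1`, `β := N_βr₀`,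
`β_K := 8p_K⁰r₀`, every radius window by (CRWT), the curvature letter bounded by `p_K⁰`; the local part's window `p_K∕2 + 3(2+a)β² + β_K ≤ γ∕4` follows from the
`G₁` window of (CRWT) (`3(2+a) ≤ 21+3a`, the `C_P`∕`ρ` terms are nonnegative).  Displayed: `γ` + `hpos₀`, the idle `G′_k`-side letters, the MODEL letters.
[cite: Balaban1985BackgroundPropagators, (3.26) p.395, (3.15)–(3.16) p.393, (3.49) p.399, Thm 3.11 p.416] -/
theorem exists_rate_block_decay_localInvK_closed (d : ℕ) :
    ∃ r₀ : ℝ, r₀ = min (1 / 4) (min (1 / (2 * (d : ℝ) + 1)) (min (1 / (4 * (Mφ * Mφ') * (d * Real.sqrt d) + 4 * (Mφ * Mφ') * d + 2 * (Mφ * Mφ') * Real.sqrt d + Mφ' * Mφ * (Real.exp 1 * Real.exp (Real.sqrt ((L : ℝ) ^ d) * (Real.sqrt (2 * d) * (102 * (d + 1) ^ 2 * L)) * (εs / (1 - ϱ))) * (Real.sqrt ((L : ℝ) ^ d) * ((3 * 1 + (2 * d + 1) * 1) * (2 * Real.sqrt (2 * (2 * d * (102 * (d + 1) ^ 2 * L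 * εs) ^ 2 + 1)))))) + 1)) (min (1 / (Real.sqrt ((L : ℝ) ^ d) * ((3 * 1 + (2 * d + 1) * 1) * (2 * Real.sqrt (2 * (2 * d * (102 * (d + 1) ^ 2 * L * εs) ^ 2 + 1)))))) (min (1 / (2 * (Mφ * Mφ') * Real.sqrt d + 2 * M + 1)) (min (γ' / (12 * (1 + a') * (2 * (Mφ * Mφ') * Real.sqrt d + 2 * M + 1))) (min (Real.sqrt κ₁ / (120 * ((2 * (Mφ * Mφ') * Real.sqrt d + 2 * M + 1) * (4 / γ' + M * ((4 / γ') ^ 2 * (3 + a' * (2 * M + 1))))))) (min ((γ / 4 - pK0 / 2) / ((21 + 3 * a) * (4 * (Mφ * Mφ') * (d * Real.sqrt d) + 4 * (Mφ * Mφ') * d + 2 * (Mφ * Mφ') * Real.sqrt d + Mφ' * Mφ * (Real.exp 1 * Real.exp (Real.sqrt ((L : ℝ) ^ d) * (Real.sqrt (2 * d) * (102 * (d + 1) ^ 2 * L)) * (εs / (1 - ϱ))) * (Real.sqrt ((L : ℝ) ^ d) * ((3 * 1 + (2 * d + 1) * 1) * (2 * Real.sqrt (2 * (2 * d * (102 *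 (d + 1) ^ 2 * L * εs) ^ 2 + 1)))))) + 1) + 4 * (4 * (Mφ * Mφ') * (d * Real.sqrt d) + 4 * (Mφ * Mφ') * d + 2 * (Mφ * Mφ') * Real.sqrt d + Mφ' * Mφ * (Real.exp 1 * Real.exp (Real.sqrt ((L : ℝ) ^ d) * (Real.sqrt (2 * d) * (102 * (d + 1) ^ 2 * L)) * (εs / (1 - ϱ))) * (Real.sqrt ((L : ℝ) ^ d) * ((3 * 1 + (2 * d + 1) * 1) * (2 * Real.sqrt (2 * (2 * d * (102 * (d + 1) ^ 2 * L * εs) ^ 2 + 1)))))) + 1) * Real.sqrt (M / Real.sqrt κ₁) + 2 * (15 * ((2 * (Mφ * Mφ') * Real.sqrt d + 2 * M + 1) * (4 / γ' + M * ((4 / γ') ^ 2 * (3 + a' * (2 * M + 1))))) / Real.sqrt κ₁) * Real.sqrt (M / Real.sqrt κ₁) ^ 2 + 8 * pK0)) (((1 : ℝ) / 2) / ((4 * (Mφ * Mφ') * (d * Real.sqrt d) + 4 * (Mφ * Mφ') * d + 2 * (Mφ * Mφ') * Real.sqrt d + Mφ' * Mφ * (Real.exp 1 * Real.exp (Real.sqrt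 ((L : ℝ) ^ d) * (Real.sqrt (2 * d) * (102 * (d + 1) ^ 2 * L)) * (εs / (1 - ϱ))) * (Real.sqrt ((L : ℝ) ^ d) * ((3 * 1 + (2 * d + 1) * 1) * (2 * Real.sqrt (2 * (2 * d * (102 * (d + 1) ^ 2 * L * εs) ^ 2 + 1)))))) + 1) * (4 / γ) * (2 * (Mφ' * Mφ * Real.exp (Real.sqrt ((L : ℝ) ^ d) * (Real.sqrt (2 * d) * (102 * (d + 1) ^ 2 * L)) * (εs / (1 - ϱ)))) + 1) + (Mφ' * Mφ * Real.exp (Real.sqrt ((L : ℝ) ^ d) * (Real.sqrt (2 * d) * (102 * (d + 1) ^ 2 * L)) * (εs / (1 - ϱ)))) * ((Mφ' * Mφ * Real.exp (Real.sqrt ((L : ℝ) ^ d) * (Real.sqrt (2 * d) * (102 * (d + 1) ^ 2 * L)) * (εs / (1 - ϱ)))) + 1) * ((4 * (Mφ * Mφ') * (d * Real.sqrt d) + 4 * (Mφ * Mφ') * d + 2 * (Mφ * Mφ') * Real.sqrt d + Mφ' * Mφ * (Real.exp 1 * Real.exp (Real.sqrt ((L : ℝ) ^ d) * (Real.sqrt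 (2 * d) * (102 * (d + 1) ^ 2 * L)) * (εs / (1 - ϱ))) * (Real.sqrt ((L : ℝ) ^ d) * ((3 * 1 + (2 * d + 1) * 1) * (2 * Real.sqrt (2 * (2 * d * (102 * (d + 1) ^ 2 * L * εs) ^ 2 + 1)))))) + 1) * (4 / γ * (2 * (8 / γ) + (8 / γ + 4 / γ) + 2 * ((8 / γ + 4 / γ * Real.sqrt (M / Real.sqrt κ₁)) + 4 / γ) + a * (Mφ' * Mφ * Real.exp (Real.sqrt ((L : ℝ) ^ d) * (Real.sqrt (2 * d) * (102 * (d + 1) ^ 2 * L)) * (εs / (1 - ϱ)))) * (4 / γ) + a * ((Mφ' * Mφ * Real.exp (Real.sqrt ((L : ℝ) ^ d) * (Real.sqrt (2 * d) * (102 * (d + 1) ^ 2 * L)) * (εs / (1 - ϱ)))) + 1) * (4 / γ))) + (15 * ((2 * (Mφ * Mφ') * Real.sqrt d + 2 * M + 1) * (4 / γ' + M * ((4 / γ') ^ 2 * (3 + a' * (2 * M + 1))))) / Real.sqrt κ₁) * ((8 / γ + 4 / γ * Real.sqrt (M / Real.sqrt κ₁)) * ((8 / γ + 4 / γ * Real.sqrt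 (M / Real.sqrt κ₁)) + 4 / γ)) + 8 * pK0 * (4 / γ) ^ 2)))))))))) ∧ 0 < r₀ ∧
      ∀ (n : ℕ) (η : ℝ) (_hη : 0 < η) (_hηL : η * (L : ℝ) ^ (n + 1) = 1) (c₀ c₁ : ℝ) [Fact (0 < c₀)] [Fact (0 < c₁)]
        (_hdiag : c₀ * ((L : ℝ) ^ (n + 1)) ^ d = c₁) (m : Fin d → ℕ) [∀ i, NeZero (m i)] (_hm : ∀ i, 1 ≤ m i)
        (U : Bond d (towerP L m (n + 1)) → 𝔸ˣ) (_hU : ∀ b, U b ∈ U1 𝔸)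
        (_hRS : ∀ (b : Bond d (towerP L m (n + 1))) (v u : W), ⟪adTransportW φ U b v, u⟫_ℂ = ⟪v, adTransportW φ (fun b => (U b)⁻¹) b u⟫_ℂ)
        (α : ℕ → ℝ) (_hα0 : ∀ j, 0 ≤ α j) (hα1 : ∀ j, α j ≤ 1 / 64)
        (hU1 : ∀ (j : ℕ) (x : B7Prop1Explicit.Site d) (k : Fin d), perCfg (towerP L m (j + 1)) (UlevOf L m (n + 1) U j) x k ∈ U1 𝔸)
        (hreg : ∀ (j : ℕ) (y : TSite d (towerP L m j)) (k : Fin d) (ρ' : Fin d → Fin L),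
          ‖((Wcx L (perCfg (towerP L m (j + 1)) (UlevOf L m (n + 1) U j)) (cornerSite L y) k (boxVec L ρ') : 𝔸ˣ) : 𝔸) - 1‖ ≤ α j)
        (εU : ℕ → ℝ) (_hεU : ∀ j, 0 ≤ εU j) (_hUε : ∀ (j : ℕ) (b : Bond d (towerP L m (j + 1))), ‖(UlevOf L m (n + 1) U j b : 𝔸) - 1‖ ≤ εU j)
        (_hεg : ∀ j < n + 1, εU j ≤ εs * ϱ ^ j)
        (δ : ℝ) (_hδ : 0 ≤ δ) (_hRe : ∀ p : B9SectCLatticeCarrier.Plaq d (towerP L m (n + 1)), ‖reHol U p - 1‖ ≤ δ)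
        (_hIm : ∀ p : B9SectCLatticeCarrier.Plaq d (towerP L m (n + 1)), ‖imHol U p‖ ≤ δ)
        (_hpK : (768 * Fintype.card (DirPair d) * Mτ * Mφ ^ 2 * (‖((η : ℂ)) ^ d‖ / c₀) * ‖((η : ℂ))⁻¹‖ ^ 2 * δ) ≤ pK0)
        (A₀ : BondL2K ℂ d (towerP L m (n + 1)) c₀ W →ₗ[ℂ] BondL2K ℂ d (towerP L m (n + 1)) c₀ W)
        (_hA₀ : A₀ = hessOp φ η U τ + covDerivL2K ℂ c₀ ((η : ℂ))⁻¹ (adTransportW φ U) ∘ₗ covDivL2K ℂ c₀ ((η : ℂ))⁻¹ (adTransportW φ fun b => (U b)⁻¹) +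
          LinearMap.adjoint (QkW L m n φ U (le_trans one_le_two hL2) α hα1 hU1 hreg (c₀ := c₀) (c₁ := c₁)) ∘ₗ
            ((a : ℂ) • QkW L m n φ U (le_trans one_le_two hL2) α hα1 hU1 hreg (c₀ := c₀) (c₁ := c₁)))
        (hpos₀ : ∀ x : BondL2K ℂ d (towerP L m (n + 1)) c₀ W, x ≠ 0 → 0 < RCLike.re ⟪x, A₀ x⟫_ℂ)
        (_hcoer : ∀ f : BondL2K ℂ d (towerP L m (n + 1)) c₀ W, γ * ‖f‖ ^ 2 ≤ RCLike.re ⟪f, A₀ f⟫_ℂ)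
        (PB : TSite d m → BondL2K ℂ d (towerP L m (n + 1)) c₀ W →L[ℂ] BondL2K ℂ d (towerP L m (n + 1)) c₀ W)
        (_hPB : ∀ (y : TSite d m) (f : BondL2K ℂ d (towerP L m (n + 1)) c₀ W) (b : Bond d (towerP L m (n + 1))),
          WL2.equiv ℂ (fun _ : Bond d (towerP L m (n + 1)) => c₀) W (PB y f) b =
            if blockCoord (L ^ (n + 1)) m (siteCast (towerP_eq_fineP_pow L m (n + 1)) (bpos b)) = y then
              WL2.equiv ℂ (fun _ : Bond d (towerP L m (n + 1)) => c₀) W f b else 0)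
        (y₀ y₁ : TSite d m),
        ‖PB y₁ ∘L LinearMap.toContinuousLinearMap (greenK A₀ hpos₀) ∘L PB y₀‖ ≤ 4 / γ * Real.exp r₀ * Real.exp (-(r₀ * tdist m y₀ y₁)) := by
  have hL1 : 1 ≤ L := le_trans one_le_two hL2
  refine ⟨_, rfl, radiusT0_pos (d := d) (εs := εs) (ϱ := ϱ) hL1 hMφ hMφ' ha ha' hγ' hκ₁ hM hγ one_pos hpK0 hgap, ?_⟩
  intro n η hη hηL c₀ c₁ _ _ hdiag m _ hm U hU hRS α hα0 hα1 hU1 hreg εU hεU hUε hεg δ hδ hRe hIm hpK A₀ hA₀ hpos₀ hcoer PB hPB y₀ y₁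
  -- the radius and its nine ratio bounds
  set r₀ : ℝ := min (1 / 4) (min (1 / (2 * (d : ℝ) + 1)) (min (1 / (4 * (Mφ * Mφ') * (d * Real.sqrt d) + 4 * (Mφ * Mφ') * d + 2 * (Mφ * Mφ') * Real.sqrt d + Mφ' * Mφ * (Real.exp 1 * Real.exp (Real.sqrt ((L : ℝ) ^ d) * (Real.sqrt (2 * d) * (102 * (d + 1) ^ 2 * L)) * (εs / (1 - ϱ))) * (Real.sqrt ((L : ℝ) ^ d) * ((3 * 1 + (2 * d + 1) * 1) * (2 * Real.sqrt (2 * (2 * d * (102 * (d + 1) ^ 2 * L * εs) ^ 2 + 1)))))) + 1)) (min (1 / (Real.sqrt ((L : ℝ) ^ d) * ((3 * 1 + (2 * d + 1) * 1) * (2 * Real.sqrt (2 * (2 * d * (102 * (d + 1) ^ 2 * L * εs) ^ 2 + 1)))))) (min (1 / (2 * (Mφ * Mφ') * Real.sqrt d + 2 * M + 1)) (min (γ' / (12 * (1 + a') * (2 * (Mφ * Mφ') * Real.sqrt d + 2 * M + 1))) (min (Real.sqrt κ₁ / (120 * ((2 * (Mφ * Mφ') * Real.sqrt d + 2 * M +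 1) * (4 / γ' + M * ((4 / γ') ^ 2 * (3 + a' * (2 * M + 1))))))) (min ((γ / 4 - pK0 / 2) / ((21 + 3 * a) * (4 * (Mφ * Mφ') * (d * Real.sqrt d) + 4 * (Mφ * Mφ') * d + 2 * (Mφ * Mφ') * Real.sqrt d + Mφ' * Mφ * (Real.exp 1 * Real.exp (Real.sqrt ((L : ℝ) ^ d) * (Real.sqrt (2 * d) * (102 * (d + 1) ^ 2 * L)) * (εs / (1 - ϱ))) * (Real.sqrt ((L : ℝ) ^ d) * ((3 * 1 + (2 * d + 1) * 1) * (2 * Real.sqrt (2 * (2 * d * (102 * (d + 1) ^ 2 * L * εs) ^ 2 + 1)))))) + 1) + 4 * (4 * (Mφ * Mφ') * (d * Real.sqrt d) + 4 * (Mφ * Mφ') * d + 2 * (Mφ * Mφ') * Real.sqrt d + Mφ' * Mφ * (Real.exp 1 * Real.exp (Real.sqrt ((L : ℝ) ^ d) * (Real.sqrt (2 * d) * (102 * (d + 1) ^ 2 * L)) * (εs / (1 - ϱ))) * (Real.sqrt ((L : ℝ) ^ d) * ((3 * 1 + (2 * d + 1) * 1) * (2 * Real.sqrt (2 * (2 *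 d * (102 * (d + 1) ^ 2 * L * εs) ^ 2 + 1)))))) + 1) * Real.sqrt (M / Real.sqrt κ₁) + 2 * (15 * ((2 * (Mφ * Mφ') * Real.sqrt d + 2 * M + 1) * (4 / γ' + M * ((4 / γ') ^ 2 * (3 + a' * (2 * M + 1))))) / Real.sqrt κ₁) * Real.sqrt (M / Real.sqrt κ₁) ^ 2 + 8 * pK0)) (((1 : ℝ) / 2) / ((4 * (Mφ * Mφ') * (d * Real.sqrt d) + 4 * (Mφ * Mφ') * d + 2 * (Mφ * Mφ') * Real.sqrt d + Mφ' * Mφ * (Real.exp 1 * Real.exp (Real.sqrt ((L : ℝ) ^ d) * (Real.sqrt (2 * d) * (102 * (d + 1) ^ 2 * L)) * (εs / (1 - ϱ))) * (Real.sqrt ((L : ℝ) ^ d) * ((3 * 1 + (2 * d + 1) * 1) * (2 * Real.sqrt (2 * (2 * d * (102 * (d + 1) ^ 2 * L * εs) ^ 2 + 1)))))) + 1) * (4 / γ) * (2 * (Mφ' * Mφ * Real.exp (Real.sqrt ((L : ℝ) ^ d) * (Real.sqrt (2 * d) * (102 * (d + 1) ^ 2 * L)) * (εs / (1 - ϱ))))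 + 1) + (Mφ' * Mφ * Real.exp (Real.sqrt ((L : ℝ) ^ d) * (Real.sqrt (2 * d) * (102 * (d + 1) ^ 2 * L)) * (εs / (1 - ϱ)))) * ((Mφ' * Mφ * Real.exp (Real.sqrt ((L : ℝ) ^ d) * (Real.sqrt (2 * d) * (102 * (d + 1) ^ 2 * L)) * (εs / (1 - ϱ)))) + 1) * ((4 * (Mφ * Mφ') * (d * Real.sqrt d) + 4 * (Mφ * Mφ') * d + 2 * (Mφ * Mφ') * Real.sqrt d + Mφ' * Mφ * (Real.exp 1 * Real.exp (Real.sqrt ((L : ℝ) ^ d) * (Real.sqrt (2 * d) * (102 * (d + 1) ^ 2 * L)) * (εs / (1 - ϱ))) * (Real.sqrt ((L : ℝ) ^ d) * ((3 * 1 + (2 * d + 1) * 1) * (2 * Real.sqrt (2 * (2 * d * (102 * (d + 1) ^ 2 * L * εs) ^ 2 + 1)))))) + 1) * (4 / γ * (2 * (8 / γ) + (8 / γ + 4 / γ) + 2 * ((8 / γ + 4 / γ * Real.sqrt (M / Real.sqrt κ₁)) + 4 / γ) + a * (Mφ' * Mφ * Real.exp (Real.sqrt ((L : ℝ) ^ d)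 * (Real.sqrt (2 * d) * (102 * (d + 1) ^ 2 * L)) * (εs / (1 - ϱ)))) * (4 / γ) + a * ((Mφ' * Mφ * Real.exp (Real.sqrt ((L : ℝ) ^ d) * (Real.sqrt (2 * d) * (102 * (d + 1) ^ 2 * L)) * (εs / (1 - ϱ)))) + 1) * (4 / γ))) + (15 * ((2 * (Mφ * Mφ') * Real.sqrt d + 2 * M + 1) * (4 / γ' + M * ((4 / γ') ^ 2 * (3 + a' * (2 * M + 1))))) / Real.sqrt κ₁) * ((8 / γ + 4 / γ * Real.sqrt (M / Real.sqrt κ₁)) * ((8 / γ + 4 / γ * Real.sqrt (M / Real.sqrt κ₁)) + 4 / γ)) + 8 * pK0 * (4 / γ) ^ 2)))))))))) with hr₀def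
  have hr₀pos : 0 < r₀ := radiusT0_pos (d := d) (εs := εs) (ϱ := ϱ) hL1 hMφ hMφ' ha ha' hγ' hκ₁ hM hγ one_pos hpK0 hgap
  have hr0 : 0 ≤ r₀ := hr₀pos.le
  obtain ⟨h1, h2, h3, h4, h5, h6, h7, h8, -⟩ := le_ratios_of_le_radiusT0 (le_refl r₀)
  -- the windows
  obtain ⟨hwin, hwin0, hwin1, hwin'⟩ := eta_windows (d := d) hL1 n hη hηL hr0 h1 h2
  obtain ⟨hβ0, -, hβ'0, -, -, -, hρ0, -, hwinT⟩ := unit_windows hL1 hMφ hMφ' ha' hγ' hκ₁ hM hr0 h3 h4 h5 h6 h7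
  obtain ⟨hβCC, hβC, hβD, hβTs, -, -, -⟩ := slopes_le (d := d) (L := L) (εs := εs) (ϱ := ϱ) hMφ hMφ' hM hpK0 hr0
  have hsmall := small_window hL1 hMφ hMφ' ha ha' hγ' hκ₁ hM hpK0 hr0 h3 h8
  -- the diagonal weight ratio is `1`
  have hc₀ : 0 < c₀ := Fact.out
  have hW1 : Real.sqrt (c₁ / (c₀ * ((L : ℝ) ^ (n + 1)) ^ d)) = 1 := by
    rw [← hdiag, div_self (by positivity), Real.sqrt_one]
  -- `η ≤ 1` and the curvature letter
  have hL1r : (1 : ℝ) ≤ (L : ℝ) ^ (n + 1) := one_le_pow₀ (by exact_mod_cast hL1)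
  have hη1 : η ≤ 1 := by
    have hηeq : η = ((L : ℝ) ^ (n + 1))⁻¹ := eq_inv_of_mul_eq_one_left hηL
    rw [hηeq]; exact inv_le_one_of_one_le₀ hL1r
  have hpKnn : 0 ≤ (768 * Fintype.card (DirPair d) * Mτ * Mφ ^ 2 * (‖((η : ℂ)) ^ d‖ / c₀) * ‖((η : ℂ))⁻¹‖ ^ 2 * δ) := by positivity
  have hβK : 8 * (r₀ * (1 * η)) * (768 * Fintype.card (DirPair d) * Mτ * Mφ ^ 2 * (‖((η : ℂ)) ^ d‖ / c₀) * ‖((η : ℂ))⁻¹‖ ^ 2 * δ) ≤ 8 * pK0 * r₀ := by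
    have h1' : r₀ * (1 * η) ≤ r₀ := by rw [one_mul]; exact mul_le_of_le_one_right hr0 hη1
    calc 8 * (r₀ * (1 * η)) * (768 * Fintype.card (DirPair d) * Mτ * Mφ ^ 2 * (‖((η : ℂ)) ^ d‖ / c₀) * ‖((η : ℂ))⁻¹‖ ^ 2 * δ) ≤ 8 * r₀ * pK0 := by
          apply mul_le_mul (by linarith) hpK hpKnn (by positivity)
      _ = 8 * pK0 * r₀ := by ring
  -- the tower `dQ` window, linearised
  have hdiff := tower_dQ_diff_le_linear (d := d) hL2 n hηL εU hεU hϱ0 hϱ1 hεs hεg hr0 zero_le_one zero_le_one hwinT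
  have hβT : Mφ' * Mφ * Real.sqrt (c₁ / (c₀ * ((L : ℝ) ^ (n + 1)) ^ d)) *
      ((∏ j ∈ Finset.range (n + 1), (1 + Real.sqrt ((L : ℝ) ^ d) * (Real.sqrt (2 * d) * (102 * (d + 1) ^ 2 * L * εU j) +
          2 * (r₀ * (if j = 0 then 3 * 1 + (L : ℝ) ^ (n + 1) * (1 * η) else 2 * d * (L : ℝ) ^ (n + 1 - j) * (1 * η))) *
            Real.sqrt (2 * (2 * d * (102 * (d + 1) ^ 2 * L * εU j) ^ 2 + ((L : ℝ) ^ d)⁻¹))))) -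
        ∏ j ∈ Finset.range (n + 1), (1 + Real.sqrt ((L : ℝ) ^ d) * (Real.sqrt (2 * d) * (102 * (d + 1) ^ 2 * L * εU j)))) ≤ (4 * (Mφ * Mφ') * (d * Real.sqrt d) + 4 * (Mφ * Mφ') * d + 2 * (Mφ * Mφ') * Real.sqrt d + Mφ' * Mφ * (Real.exp 1 * Real.exp (Real.sqrt ((L : ℝ) ^ d) * (Real.sqrt (2 * d) * (102 * (d + 1) ^ 2 * L)) * (εs / (1 - ϱ))) * (Real.sqrt ((L : ℝ) ^ d) * ((3 * 1 + (2 * d + 1) * 1) * (2 * Real.sqrt (2 * (2 * d * (102 * (d + 1) ^ 2 * L * εs) ^ 2 + 1)))))) + 1) * r₀ := by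
    have hMM1 : Mφ' * Mφ * Real.sqrt (c₁ / (c₀ * ((L : ℝ) ^ (n + 1)) ^ d)) = Mφ' * Mφ := by rw [hW1, mul_one]
    rw [hMM1]
    have hMM : 0 ≤ Mφ' * Mφ := mul_nonneg hMφ' hMφ
    have hlin : (∏ j ∈ Finset.range (n + 1), (1 + Real.sqrt ((L : ℝ) ^ d) * (Real.sqrt (2 * d) * (102 * (d + 1) ^ 2 * L * εU j) +
          2 * (r₀ * (if j = 0 then 3 * 1 + (L : ℝ) ^ (n + 1) * (1 * η) else 2 * d * (L : ℝ) ^ (n + 1 - j) * (1 * η))) *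
            Real.sqrt (2 * (2 * d * (102 * (d + 1) ^ 2 * L * εU j) ^ 2 + ((L : ℝ) ^ d)⁻¹))))) -
        ∏ j ∈ Finset.range (n + 1), (1 + Real.sqrt ((L : ℝ) ^ d) * (Real.sqrt (2 * d) * (102 * (d + 1) ^ 2 * L * εU j))) ≤ (Real.exp 1 * Real.exp (Real.sqrt ((L : ℝ) ^ d) * (Real.sqrt (2 * d) * (102 * (d + 1) ^ 2 * L)) * (εs / (1 - ϱ))) * (Real.sqrt ((L : ℝ) ^ d) * ((3 * 1 + (2 * d + 1) * 1) * (2 * Real.sqrt (2 * (2 * d * (102 * (d + 1) ^ 2 * L * εs) ^ 2 + 1)))))) * r₀ := by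
      refine hdiff.trans (le_of_eq ?_); ring
    exact (mul_le_mul_of_nonneg_left hlin hMM).trans hβTs
  -- `small` with the curvature letter bounded by `p_K⁰`
  have small : (768 * Fintype.card (DirPair d) * Mτ * Mφ ^ 2 * (‖((η : ℂ)) ^ d‖ / c₀) * ‖((η : ℂ))⁻¹‖ ^ 2 * δ) / 2 + (21 + 3 * a) * ((4 * (Mφ * Mφ') * (d * Real.sqrt d) + 4 * (Mφ * Mφ') * d + 2 * (Mφ * Mφ') * Real.sqrt d + Mφ' * Mφ * (Real.exp 1 * Real.exp (Real.sqrt ((L : ℝ) ^ d) * (Real.sqrt (2 * d) * (102 * (d + 1) ^ 2 * L)) * (εs / (1 - ϱ))) * (Real.sqrt ((L : ℝ) ^ d) * ((3 * 1 + (2 * d + 1) * 1) * (2 * Real.sqrt (2 * (2 * d * (102 * (d + 1) ^ 2 * L * εs) ^ 2 + 1)))))) + 1) * r₀) ^ 2 + 4 * ((4 * (Mφ * Mφ') * (d * Real.sqrt d) + 4 * (Mφ * Mφ') * d + 2 * (Mφ * Mφ') * Real.sqrt d + Mφ' * Mφ * (Real.exp 1 * Real.exp (Real.sqrt ((L : ℝ)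 ^ d) * (Real.sqrt (2 * d) * (102 * (d + 1) ^ 2 * L)) * (εs / (1 - ϱ))) * (Real.sqrt ((L : ℝ) ^ d) * ((3 * 1 + (2 * d + 1) * 1) * (2 * Real.sqrt (2 * (2 * d * (102 * (d + 1) ^ 2 * L * εs) ^ 2 + 1)))))) + 1) * r₀) * Real.sqrt (M / Real.sqrt κ₁) +
      2 * ((6 * ((2 * (Mφ * Mφ') * Real.sqrt d + 2 * M + 1) * r₀ * (4 / γ' + M * ((4 / γ') ^ 2 * (3 + a' * (2 * M + 1))))) + 9 * ((2 * (Mφ * Mφ') * Real.sqrt d + 2 * M + 1) * r₀ * (4 / γ' + M * ((4 / γ') ^ 2 * (3 + a' * (2 * M + 1)))))) / Real.sqrt κ₁) * (Real.sqrt (M / Real.sqrt κ₁)) ^ 2 + 8 * pK0 * r₀ ≤ γ / 4 := by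
    have : (768 * Fintype.card (DirPair d) * Mτ * Mφ ^ 2 * (‖((η : ℂ)) ^ d‖ / c₀) * ‖((η : ℂ))⁻¹‖ ^ 2 * δ) / 2 ≤ pK0 / 2 := by linarith
    linarith [hsmall]
  -- the local part's window from the `G₁` window: `3(2+a) ≤ 21+3a`, the `C_P` ∕ `ρ` terms are nonnegative
  have hCP0 : 0 ≤ Real.sqrt (M / Real.sqrt κ₁) := Real.sqrt_nonneg _
  exact norm_block_localInvK_le_closed L m n φ hφ hφ' hMφ hMφ' hstar hη hηL U hU hRS τ hτ hMτ hL1 hm α hα1 hU1 hreg εU hεU hUε hδ hRe hIm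
    (r := r₀) (ℓ := 1) (ℓ' := 1) hr0 le_rfl le_rfl hβ0 hwin hwin0 hwin1 hβCC hβC hβD hβT hβK a ha A₀ hA₀ hpos₀ hγ hcoer
    (small_local_of_small hβ0 hCP0 hρ0 small) PB hPB y₀ y₁

end Literature.MathematicalPhysics.QuantumFieldTheory.Balaban1983to89.B9Eq326LocalPartBlockDecayTowerClosedRadius

end
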